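import Mathlib
import Summits.Ventures.PercRepro.TriangleCapEightThirteenE
import Summits.Ventures.PercRepro.TriangleCapThreeTrianglesF

/-!
# PercRepro — THE CELL `(8, 13)`, PART F: ONE TRIANGLE WITHOUT AN OUTER VERTEX, THE THEOREM (p3, gen 37; part 78)

**`one_triangle_eight_thirteen_no_outer`**: `K₄⁻`-free on `8` vertices with `13` edges, the only triangle `u v w`,
no outer vertex ⇒ `Σ_v d(v)² + 10 ≤ 104` — the count of TriangleCapEightThirteenE assembled:
`Σ deficit ≥ 100 − 2 Σ d_x² − 2 Σ_{y ∉ S} d(y)² ≥ 26`.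
Axioms: standard.
-/

namespace PercRepro

namespace TriangleCap

namespace C047

open Finset

variable {V : Type*} [Fintype V] [DecidableEq V]

omit [Fintype V] [DecidableEq V] in
/-- The linear assembly of the cell `(8, 13)` (one triangle, no outer vertex). -/
theorem eight_thirteen_arith {X F1 F2 T B1 B2 B3 B4 C1 C2 C3 C4 Q' sq sqP : ℕ}
    (hid : 2 * X + (F1 + F2) = 2 * 13 * 8 + T) (hT : T ≤ 6) (hfarR : F2 = B1 + B2 + (B3 + B4))
    (hSS : 5 * 6 ≤ B4 + 2 * 10) (hcross : 5 * 5 ≤ B2 + Q' + sq) (hswap : B3 = B2)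
    (hB1 : 5 * Q' ≤ B1 + 2 * sqP)
    (hfarS : F1 = C1 + C2 + (C3 + C4)) (hout : 3 * Q' ≤ C4 + 2 * Q') (hQ : Q' = 10)
    (hDef : 26 ≤ 100 - 2 * sq - 2 * sqP) :
    X + 2 * (8 - 3) ≤ 13 * 8 := by
  omega

/-- **THE CELL `(8, 13)`, ONE TRIANGLE, NO OUTER VERTEX.** -/
theorem one_triangle_eight_thirteen_no_outer (D : SimpleGraph V) [DecidableRel D.Adj] (hK : K4mFree D)
    (hk : Fintype.card V = 8) (hm : D.edgeFinset.card = 13) {u v w : V}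
    (huv : D.Adj u v) (huw : D.Adj u w) (hvw : D.Adj v w)
    (hT : ∀ a b c, D.Adj a b → D.Adj a c → D.Adj b c → a = u ∨ a = v ∨ a = w)
    (hq : ∀ z, z ∉ ({u, v, w} : Finset V) → 1 ≤ degIn D {u, v, w} z) :
    ∑ v, deg D v * deg D v + 2 * (Fintype.card V - 3) ≤ D.edgeFinset.card * Fintype.card V := by
  set S : Finset V := {u, v, w} with hS
  have h3 : S.card = 3 := card_triple huv.ne huw.ne hvw.ne
  have hcl := clique_triple D huv huw hvw
  have hRcard : Sᶜ.card = 5 := by rw [card_compl, h3, hk]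
  have hQ : adjPairs D S = 6 := by
    rw [adjPairs_eq_sum_degIn, sum_congr rfl (fun x hx => degIn_self_of_clique D h3 hcl hx), sum_const, h3,
      smul_eq_mul]
  have hs1 : ∀ z ∈ Sᶜ, degIn D S z = 1 := by
    intro z hz
    have h1 : degIn D S z ≤ 1 := degIn_le_one_of_triangle D hK huv huw hvw (mem_compl.mp hz)
    have h2 : 1 ≤ degIn D S z := hq z (mem_compl.mp hz)
    omega
  have hsum1 : ∑ z ∈ Sᶜ, degIn D S z = 5 := by
    rw [sum_congr rfl hs1, sum_const, hRcard, smul_eq_mul]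
  have hcomm := sum_degIn_comm D S Sᶜ
  rw [hsum1] at hcomm
  have hdens := two_mul_card_edges_eq_adjPairs_add D S
  rw [hQ, hsum1, hm] at hdens
  set Q' := ∑ z ∈ Sᶜ, degIn D Sᶜ z with hQ'
  have hQ'10 : Q' = 10 := by omega
  have hW' : ∑ x ∈ S, ∑ y ∈ Sᶜ.filter (fun y => D.Adj x y), degIn D Sᶜ y = Q' := by
    rw [hQ']
    have := double_sum_ite_swap D Sᶜ S (fun y _ => degIn D Sᶜ y)
    rw [double_sum_ite_left] at this
    rw [← this]
    exact sum_congr rfl (fun y hy => by rw [hs1 y hy, one_mul])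
  -- the far count of the vertices off `S`: the four blocks for `Sᶜ`
  have hfarR := sum_far_eq_double D Sᶜ
  rw [double_sum_split Sᶜ, compl_compl] at hfarR
  have hcross := block_cross D Sᶜ
  rw [compl_compl, hcomm, hW', hRcard] at hcross
  have hswap := block_cross_swap D Sᶜ
  rw [compl_compl] at hswap
  have hSS := block_outside D Sᶜ
  rw [compl_compl, hRcard] at hSS
  have hSSdeg : ∑ x ∈ S, degIn D S x = 6 := by
    rw [sum_congr rfl (fun x hx => degIn_self_of_clique D h3 hcl hx), sum_const, h3, smul_eq_mul]
  have hSSprod : ∑ x ∈ S, degIn D Sᶜ x * degIn D S x = 10 := by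
    have e : ∀ x ∈ S, degIn D Sᶜ x * degIn D S x = degIn D Sᶜ x * 2 := fun x hx => by
      rw [degIn_self_of_clique D h3 hcl hx]
    calc ∑ x ∈ S, degIn D Sᶜ x * degIn D S x = (∑ x ∈ S, degIn D Sᶜ x) * 2 := by
          rw [sum_congr rfl e, sum_mul]
      _ = 10 := by rw [hcomm]
  rw [hSSdeg, hSSprod] at hSS
  have hB1 := block_inside_self D Sᶜ
  rw [hRcard, ← hQ'] at hB1
  -- the far count of the vertices of `S`: the block `Sᶜ × Sᶜ`
  have hfarS := sum_far_eq_double D S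
  rw [double_sum_split S] at hfarS
  have hout := block_outside D S
  rw [h3] at hout
  have hsd : ∑ z ∈ Sᶜ, degIn D S z * degIn D Sᶜ z = Q' := by
    rw [hQ']
    exact sum_congr rfl (fun z hz => by rw [hs1 z hz, one_mul])
  rw [hsd] at hout
  -- no triangle with a vertex off `S`
  have hnotri : ∀ y, y ∉ S → ∀ y' t, D.Adj y y' → D.Adj y t → D.Adj y' t → False := by
    intro y hy y' t h1 h2 h3'
    have := hT y y' t h1 h2 h3'
    rw [hS] at hy
    simp only [mem_insert, mem_singleton] at hy
    exact hy this
  -- Mantel inside `Sᶜ`: `2 Σ d(y)² ≤ 5 Q′`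
  have hsqP := two_mul_sum_sq_le_of_no_triangle D Sᶜ (fun y hy y' _ t _ h1 h2 h3' =>
    hnotri y (mem_compl.mp hy) y' t h1 h2 h3')
  rw [hRcard, ← hQ'] at hsqP
  -- the private sets are independent: `Q′ ≤ Σ_x d_x (5 − d_x)`
  have hpriv : ∀ x ∈ S, ∀ y ∈ Sᶜ, D.Adj x y → degIn D Sᶜ y + degIn D Sᶜ x ≤ 5 := by
    intro x hx y hy hxy
    have hdisj : Disjoint (Sᶜ.filter (fun t => D.Adj y t)) (Sᶜ.filter (fun t => D.Adj x t)) := by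
      rw [disjoint_left]
      intro t ht1 ht2
      rw [mem_filter] at ht1 ht2
      exact hnotri y (mem_compl.mp hy) x t hxy.symm ht1.2 ht2.2
    have := card_le_card (union_subset (filter_subset _ _) (filter_subset _ _) :
      Sᶜ.filter (fun t => D.Adj y t) ∪ Sᶜ.filter (fun t => D.Adj x t) ⊆ Sᶜ)
    rw [card_union_of_disjoint hdisj, hRcard] at this
    exact this
  have hQ'le : Q' ≤ ∑ x ∈ S, degIn D Sᶜ x * (5 - degIn D Sᶜ x) := by
    rw [hQ']
    have e1 : ∑ y ∈ Sᶜ, degIn D Sᶜ y = ∑ x ∈ S, ∑ y ∈ Sᶜ, if D.Adj x y then degIn D Sᶜ y else 0 := by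
      rw [double_sum_ite_right]
      exact sum_congr rfl (fun y hy => by rw [hs1 y hy, one_mul])
    rw [e1]
    calc ∑ x ∈ S, ∑ y ∈ Sᶜ, (if D.Adj x y then degIn D Sᶜ y else 0) ≤
        ∑ x ∈ S, ∑ y ∈ Sᶜ, (if D.Adj x y then 5 - degIn D Sᶜ x else 0) := by
          apply sum_le_sum
          intro x hx
          apply sum_le_sum
          intro y hy
          by_cases hxy : D.Adj x y
          · simp only [hxy, if_true]
            have := hpriv x hx y hy hxy
            omega
          · simp [hxy]
      _ = ∑ x ∈ S, degIn D Sᶜ x * (5 - degIn D Sᶜ x) := double_sum_ite_left D S Sᶜ _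
  -- the private degrees `a, b, c` with `a + b + c = 5`
  have huvw : u ∉ ({v, w} : Finset V) := by
    simp only [mem_insert, mem_singleton, not_or]; exact ⟨huv.ne, huw.ne⟩
  have hvw' : v ∉ ({w} : Finset V) := by simp only [mem_singleton]; exact hvw.ne
  have e_sum : ∑ x ∈ S, degIn D Sᶜ x = degIn D Sᶜ u + (degIn D Sᶜ v + degIn D Sᶜ w) := by
    rw [hS, sum_insert huvw, sum_insert hvw', sum_singleton]
  have e_sq : ∑ x ∈ S, degIn D Sᶜ x * degIn D Sᶜ x =
      degIn D Sᶜ u * degIn D Sᶜ u + (degIn D Sᶜ v * degIn D Sᶜ v + degIn D Sᶜ w * degIn D Sᶜ w) := by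
    rw [hS, sum_insert huvw, sum_insert hvw', sum_singleton]
  have e_prod : ∑ x ∈ S, degIn D Sᶜ x * (5 - degIn D Sᶜ x) = degIn D Sᶜ u * (5 - degIn D Sᶜ u) +
      (degIn D Sᶜ v * (5 - degIn D Sᶜ v) + degIn D Sᶜ w * (5 - degIn D Sᶜ w)) := by
    rw [hS, sum_insert huvw, sum_insert hvw', sum_singleton]
  rw [e_sum] at hcomm
  rw [e_sq] at hcross
  rw [e_prod] at hQ'le
  -- the `(3, 2, 0)` partitions: `Σ d(y)² ≤ 22`
  have h320 : ∀ (p q r : V), S = {p, q, r} → p ≠ q → p ≠ r → q ≠ r → degIn D Sᶜ p = 3 → degIn D Sᶜ q = 2 →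
      degIn D Sᶜ r = 0 → ∑ y ∈ Sᶜ, degIn D Sᶜ y * degIn D Sᶜ y ≤ 22 := fun p q r hS' hpq hpr hqr hp hq' hr =>
    sum_sq_le_twentytwo D S hS' hpq hpr hqr hs1 hnotri hp hq' hr (by rw [← hQ']; exact hQ'10)
  have hid := two_mul_sum_deg_sq_add_sum_deficit D
  have h6 := card_triangles3_le_six D hT
  rw [sum_deficit_eq_sum_far, ← sum_add_sum_compl S (far D), hk, hm] at hid
  set a := degIn D Sᶜ u with ha
  set b := degIn D Sᶜ v with hb
  set c := degIn D Sᶜ w with hc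
  set sqP := ∑ y ∈ Sᶜ, degIn D Sᶜ y * degIn D Sᶜ y with hsqPdef
  -- `Σ d_x² ≤ 15`, and the partition bound
  have h15 : a * a + (b * b + c * c) ≤ 15 := partition_sq_le_fifteen a b c hcomm (by omega)
  obtain ⟨p1, p2, p3, p4, p5⟩ := triple_perm (a := u) (b := v) (c := w)
  have hS2 : S = {u, w, v} := by rw [hS]; exact p4.symm
  have hS3 : S = {v, u, w} := by rw [hS]; exact p3.symm
  have hS4 : S = {v, w, u} := by rw [hS]; exact p1.symm
  have hS5 : S = {w, u, v} := by rw [hS]; exact p2.symm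
  have hS6 : S = {w, v, u} := by rw [hS]; exact p5.symm
  have hsq' : (a = 3 ∧ b = 2) ∨ (a = 3 ∧ c = 2) ∨ (b = 3 ∧ a = 2) ∨ (b = 3 ∧ c = 2) ∨
      (c = 3 ∧ a = 2) ∨ (c = 3 ∧ b = 2) → sqP ≤ 22 := by
    rintro (⟨h1, h2⟩ | ⟨h1, h2⟩ | ⟨h1, h2⟩ | ⟨h1, h2⟩ | ⟨h1, h2⟩ | ⟨h1, h2⟩)
    · exact h320 u v w hS huv.ne huw.ne hvw.ne h1 h2 (by omega)
    · exact h320 u w v hS2 huw.ne huv.ne (Ne.symm hvw.ne) h1 h2 (by omega)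
    · exact h320 v u w hS3 (Ne.symm huv.ne) hvw.ne huw.ne h1 h2 (by omega)
    · exact h320 v w u hS4 hvw.ne (Ne.symm huv.ne) (Ne.symm huw.ne) h1 h2 (by omega)
    · exact h320 w u v hS5 (Ne.symm huw.ne) (Ne.symm hvw.ne) huv.ne h1 h2 (by omega)
    · exact h320 w v u hS6 (Ne.symm hvw.ne) (Ne.symm huw.ne) (Ne.symm huv.ne) h1 h2 (by omega)
  have hsqP25 : sqP ≤ 25 := by omega
  have hDef : 26 ≤ 100 - 2 * (a * a + (b * b + c * c)) - 2 * sqP := by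
    have := arith_eight_thirteen a b c sqP (100 - 2 * (a * a + (b * b + c * c)) - 2 * sqP) hcomm h15 hsqP25 hsq'
      (by omega)
    exact this
  rw [hk, hm]
  exact eight_thirteen_arith hid h6 hfarR hSS hcross hswap hB1 hfarS hout hQ'10 hDef

end C047

end TriangleCap

end PercRepro
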